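import Summits.BirchSwinnertonDyer.Rank1Residual.X11b.ClassClosureWeightKChainLever
import Summits.BirchSwinnertonDyer.Rank1Residual.X11b.BDPRouteRegulatorCertificate
import HarnessLib

/-!
# Class X11b = N8 at `p ≥ 5` (lane CLASS-CLOSURE, seat `cc-typer-3`): the T-WK road with the
# regulator input REPLACED by a `p`-adic `L`-function certificate — `[T^{1+e}] L_p ≠ 0` — so that
# BOTH per-pair inputs (`μ^an = 0` and the order of vanishing `1 + e`) come from ONE instrument
# (the Mazur–Tate–Teitelbaum coefficients of `E`) (cell `b2b-bsdres`)

HONEST FRAMING (verbatim, cell `b2b-bsdres`, run/shared/lean/b2b/bsd-rank1-residual/): the goal of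
the cell is to DELETE the COMBINATION-SHAPED residual classes for ALL analytic-rank `≤ 1` curves
over `ℚ` — "full BSD formula for every rank `≤ 1` curve in class `C`" assembled STRICTLY from
published theorems — so that the rank-`≤ 1` remainder becomes exactly the CONSTRUCTION-SHAPED
classes, which are TYPED (missing-input Props), NOT attempted; this is not "finishing BSD".
Lane CLASS-CLOSURE: prove what is provable now; shrink each hard class to its core with data; no
claim beyond stated classes. THEOREMS ONLY (no definition, no named fact, no `sorry`); nothing
booked; no label / RESIDUAL-MAP mark changes; X11b stays CONSTRUCTION-SHAPED; every theorem is
CONDITIONAL on the named published facts and per-pair certificates it lists; certificate rows are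
EVIDENCE / instrumentation (their worth = referee A's / the lane's ruling); Greenberg's
`μ`-conjecture and Schneider's conjecture are NEVER asserted class-wide.

## What this file does

x11c's `X11b/BDPRouteRegulatorCertificate.lean` §5 shows that, granted Disegni 2020 Thm. 1 at the
pair, the per-pair regulator input has an EQUIVALENT certificate shape on the `p`-adic `L`-function
side: `[T¹]L ≠ 0` (non-split; `regulatorNonvanishingAt_of_coeff_one_ne_zero`, class level) resp.
`[T²]L ≠ 0` (split; `schneiderConjecture_of_coeff_two_ne_zero`, datum level) for THE
Mazur–Tate–Teitelbaum function — `ord_{T} (ϖ·L_p) = 1 + e` exactly (cc-typer-6 made the same point on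
O9, `X2.schneider_of_coeff_one_ne_zero_of_thm1`). This file feeds that shape to the T-WK road
(`ClassClosureWeightKChainLever`, p274916):
* `schneiderHalf_split_of_coeff_two_ne_zero` — class level, SPLIT `p ≥ 5` with a second
  multiplicative prime: `[T²]L ≠ 0` for THE split function of every newform ⟹ the split Schneider
  half (the class-level twin of x11c's datum lemma, Disegni's (∗) supplying the display);
* `bsdp_of_namedFacts_bdd_of_coeff_ne_zero` — X11b, `p ≥ 5`, `ρ̄` onto: named facts + `MuAnZeroAt W p`
  + (`[T¹]L ≠ 0` if non-split | a second multiplicative prime ∧ `[T²]L ≠ 0` if split) ⟹ `BSD(E,p)`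
  — NO REGMULT row: both per-pair inputs are statements about the coefficients of `ϖ·L_p(E)`, i.e.
  ONE instrument (B-5 / the iw census: `μ_m = 0` and a finite valuation `v(b_{1+e})` at adequate
  precision) — the REGMULT row becomes an independent CROSS-CHECK of the same node (Disegni's identity
  equates the two), which is what the census lane's X11-REPORT calibrates;
* `forall_bsdp_five_le_of_muAnZeroAt_of_coeff_ne_zero` — class level.
A MINIMAL PAIR (`Iwasawa.UnitCoeffAt W p 1`, file `ClassClosureMinimalPair`) is the special case where
the coefficient of index `1 + e` is a UNIT. Nothing at `p = 3`; nothing booked; tier = referee A +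
x11b3 lead.

References: [Disegni2020] Thm. 1, Thm. 4, (∗); [MazurTateTeitelbaum1986Invent] §I.13–I.14, §II.10;
[EmertonPollackWeston2006] Thm. 1, 3.1.1, 5.1.3; [Wan2015] Thm. 4; [Wuthrich2014] Thm. 3, Cor. 19;
[SteinWuthrich2013] Thm. 6.1, §4.2; [Miller2011LMS] Def. 1.1; HOME/class-closure/O2/TYPER-3.md §9.
-/

set_option autoImplicit false

noncomputable section

open scoped Classical MatrixGroups ModularForm

open CongruenceSubgroup WeierstrassCurve Literature.NumberTheory.EllipticCurves
  Literature.NumberTheory.EllipticCurves.ModularForms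
  Literature.NumberTheory.EllipticCurves.Rank1Residual
  Literature.NumberTheory.EllipticCurves.Rank1Residual.Typed
  Literature.NumberTheory.EllipticCurves.Skinner2016
  Literature.NumberTheory.EllipticCurves.SteinWuthrich2013
  Literature.NumberTheory.EllipticCurves.Wuthrich2014
  Literature.NumberTheory.EllipticCurves.Disegni2020
  Literature.NumberTheory.EllipticCurves.GreenbergVatsal2000
  Literature.NumberTheory.EllipticCurves.EmertonPollackWeston2006
  Summit.BirchSwinnertonDyer.Rank1Residual.X1.MuLambda

namespace Summit.BirchSwinnertonDyer.Rank1Residual.X11b.ClassClosure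

open X11a

section Coefficient

variable (W : WeierstrassCurve ℚ) [W.IsElliptic] [W.IsGloballyMinimal] (p : ℕ) [Fact p.Prime]

/-- **Class level, SPLIT `p ≥ 5` with a second multiplicative prime: the split Schneider half from
`[T²]L ≠ 0`.** For an X11b pair split at `p`: if THE split Mazur–Tate–Teitelbaum function of every
newform of `E` has `[T²]L ≠ 0` (`hcert`: order of vanishing exactly `2 = 1 + e`), then Schneider's
conjecture holds for every modified §4.2 datum — Disegni 2020 Thm. 1 split clause (`hD`, hypothesis
(∗): `hp5`, `hm`) supplies the display at the datum and x11c's `schneiderConjecture_of_coeff_two_ne_zero`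
reads `Reg_p ≠ 0` off it; modularity (`hpar`) provides the newform and `ϖ > 0`. CONDITIONAL; nothing
booked. [cite: Disegni2020, Thm. 1 (§1.2) and Thm. 4 second bullet (§3.2), hypothesis (∗)]
[cite: MazurTateTeitelbaum1986Invent, §II.10] [cite: SteinWuthrich2013, §4.2] -/
theorem schneiderHalf_split_of_coeff_two_ne_zero (hD : thm1_padicBSD_rankOne_multiplicative)
    (hpar : nonempty_modularParametrizationData) (hX : ClassX11b W p)
    (hsplit : W.HasSplitMultiplicativeReductionAtPrime p) (hp5 : 5 ≤ p)
    (hm : ∃ (m : ℕ) (_ : Fact m.Prime), m ≠ p ∧ W.HasMultiplicativeReductionAtPrime m)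
    (hcert : ∀ {N : ℕ} [NeZero N] (f : CuspForm (Gamma0 N) 2) (L : PowerSeries ℚ_[p]),
      IsNewformOf W f → IsSplitMultPAdicLFunctionOf f p L → PowerSeries.coeff 2 L ≠ 0) :
    ∀ (Dq : TateParameterData W p) (Dh : PAdicHeightData W p),
      IsSplitMultCanonical Dh Dq → SchneiderConjecture Dh := by
  intro Dq Dh hDh
  obtain ⟨hr, hp2, hmult, -⟩ := hX
  haveI : NeZero (W.conductorNorm ℤ) := ⟨(W.conductorNorm_pos_holds).ne'⟩
  obtain ⟨Dm⟩ := hpar W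
  obtain ⟨ϖ, hϖpos, hϖ, -⟩ := Dm.exists_rat_mul_realPeriodRat_eq_plusPeriod
  obtain ⟨L, hL⟩ := exists_isSplitMultPAdicLFunctionOf hsplit Dm.isNewformOf
  obtain ⟨s, u', -, hDis⟩ := thm1_padicBSD_rankOne_multiplicative.split hD W p hp2 hmult hr
    Dm.isNewformOf ϖ hϖpos.ne' hϖ hsplit hp5 hm Dq L hL Dh hDh
  have hϖ0 : ((ϖ : ℚ) : ℚ_[p]) ≠ 0 := by exact_mod_cast hϖpos.ne'
  exact schneiderConjecture_of_coeff_two_ne_zero W p hϖ0 Dq Dh u' hDis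
    (hcert Dm.f L Dm.isNewformOf hL)

/-- **T-WK with a `p`-ADIC `L`-FUNCTION CERTIFICATE in place of the regulator row.** On X11b at
`p ≥ 5` with `ρ̄_{E,p}` onto: `BSD(E,p)` from the named published facts of the weight-`k` chain + the
lever (as in `bsdp_of_namedFacts_bdd_of_regulatorNonvanishing`) and TWO per-pair statements about
THE Mazur–Tate–Teitelbaum function(s) of `E`: `MuAnZeroAt W p` (some coefficient of `ϖ·L_p` is a unit)
and the ORDER OF VANISHING certificate — `[T¹]L ≠ 0` if `E` is non-split at `p` (`hc1`), `[T²]L ≠ 0`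
together with a second multiplicative prime if split (`hc2`, `hm`). The regulator input is DERIVED
(x11c's `regulatorNonvanishingAt_of_coeff_one_ne_zero` / `schneiderHalf_split_of_coeff_two_ne_zero`),
so ONE instrument (the `p`-adic `L`-series coefficients) supplies both inputs and a REGMULT row is an
independent cross-check of the same node. NO (ram), NO `#Ш_an` hypothesis. CONDITIONAL; nothing
booked; X11b stays CONSTRUCTION-SHAPED. [cite: EmertonPollackWeston2006, Thm. 1, Thm. 3.1.1, Thm. 5.1.3]
[cite: Wan2015, Thm. 4] [cite: Wuthrich2014, Thm. 3 (p. 382) and Cor. 19 proof (p. 399)]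
[cite: SteinWuthrich2013, Thm. 6.1 (p. 20), §4.2] [cite: Disegni2020, Thm. 1 (§1.2), hypothesis (∗)]
[cite: MazurTateTeitelbaum1986Invent, §I.13 and §II.10] [cite: Miller2011LMS, Def. 1.1] -/
theorem bsdp_of_namedFacts_bdd_of_coeff_ne_zero
    (hHida : hida_exists_congruent_ordinary_newform_of_multiplicative)
    (hMTT : exists_isCycPAdicLFunctionWeightK)
    (h311 : thm311_cotorsion_weightK_member) (hT1a : thm1_muAlg_of_weightK_member)
    (hT2 : Wan2015.thm4_rational_weightK_member_of_bdd)
    (hT1b : thm513_transfer_from_weightK_member_of_bdd)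
    (h61 : DeligneSerre1974.thm61_exists_adicGaloisRep) (h326 : Hida2000_thm326_ordinary)
    (hKato : kato_charIdeal_dvd_multiplicative_of_surjective)
    (hJn : thm61_nonsplitMultiplicative) (hJs : thm61_splitMultiplicative)
    (hHn : exists_isMultCanonical) (hHs : exists_isSplitMultCanonical)
    (hD : thm1_padicBSD_rankOne_multiplicative)
    (hGZK : rank_eq_analyticRank_of_analyticRank_le_one) (hpar : nonempty_modularParametrizationData)
    (hX : ClassX11b W p) (hp : 5 ≤ p) (hsurj : Surj W p) (hμ : MuAnZeroAt W p)
    (hc1 : ¬ W.HasSplitMultiplicativeReductionAtPrime p →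
      ∀ {N : ℕ} [NeZero N] (f : CuspForm (Gamma0 N) 2) (L : PowerSeries ℚ_[p]),
        IsNewformOf W f → IsMultPAdicLFunctionOf f p (-1) L → PowerSeries.coeff 1 L ≠ 0)
    (hm : W.HasSplitMultiplicativeReductionAtPrime p →
      ∃ (m : ℕ) (_ : Fact m.Prime), m ≠ p ∧ W.HasMultiplicativeReductionAtPrime m)
    (hc2 : W.HasSplitMultiplicativeReductionAtPrime p →
      ∀ {N : ℕ} [NeZero N] (f : CuspForm (Gamma0 N) 2) (L : PowerSeries ℚ_[p]),
        IsNewformOf W f → IsSplitMultPAdicLFunctionOf f p L → PowerSeries.coeff 2 L ≠ 0) :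
    BSDp W p := by
  have hMC : X2.MazurMainConjectureAt W p :=
    mazurMainConjectureAt_of_namedFacts_bdd W p hHida hMTT h311 hT1a hT2 hT1b h61 h326 hKato hpar hp
      hX.2.2.1 hsurj hμ
  by_cases hsplit : W.HasSplitMultiplicativeReductionAtPrime p
  · exact bsdp_of_mazurMainConjectureAt_of_split_of_five_le_of_schneider W p hJs hHs hGZK hpar
      (fun hf ϖ hϖ0 hϖ hp5' hm' Dq L hL Dh hDh =>
        thm1_padicBSD_rankOne_multiplicative.split hD W p hX.2.1 hX.2.2.1 hX.1 hf ϖ hϖ0 hϖ hsplit hp5'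
          hm' Dq L hL Dh hDh)
      hX hsplit hp (hm hsplit) hMC
      (schneiderHalf_split_of_coeff_two_ne_zero W p hD hpar hX hsplit hp (hm hsplit)
        (fun f L hf hL => hc2 hsplit f L hf hL))
  · exact bsdp_of_mazurMainConjectureAt_of_regulatorNonvanishing W p hJn hJs hHn hHs hD hGZK hpar hX
      (fun hs => absurd hs hsplit) hMC
      (regulatorNonvanishingAt_of_coeff_one_ne_zero W p hD hpar hX hsplit
        (fun f L hf hL => hc1 hsplit f L hf hL))

end Coefficient

/-! ### Class level -/

/-- **N8 ∩ {`p ≥ 5`, `ρ̄_{E,p}` onto}: `BSD(E,p)` ⇐ named published facts + `μ^an(E,p) = 0` + the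
order-of-vanishing certificate `ord_T(ϖ·L_p) = 1 + e` exactly (+ at a split `p` a second
multiplicative prime)** — the ∀-form of `bsdp_of_namedFacts_bdd_of_coeff_ne_zero`; both per-pair
inputs are statements about the `p`-adic `L`-series of `E`. No label change (referee A / x11b3
lead); CONDITIONAL; nothing booked; X11b stays CONSTRUCTION-SHAPED.
[cite: EmertonPollackWeston2006, Thm. 1, Thm. 3.1.1, Thm. 5.1.3] [cite: Wan2015, Thm. 4]
[cite: SteinWuthrich2013, Thm. 6.1, §4.2] [cite: Disegni2020, Thm. 1 (§1.2), hypothesis (∗)]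
[cite: Miller2011LMS, Def. 1.1] -/
theorem forall_bsdp_five_le_of_muAnZeroAt_of_coeff_ne_zero
    (hHida : hida_exists_congruent_ordinary_newform_of_multiplicative)
    (hMTT : exists_isCycPAdicLFunctionWeightK)
    (h311 : thm311_cotorsion_weightK_member) (hT1a : thm1_muAlg_of_weightK_member)
    (hT2 : Wan2015.thm4_rational_weightK_member_of_bdd)
    (hT1b : thm513_transfer_from_weightK_member_of_bdd)
    (h61 : DeligneSerre1974.thm61_exists_adicGaloisRep) (h326 : Hida2000_thm326_ordinary)
    (hKato : kato_charIdeal_dvd_multiplicative_of_surjective)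
    (hJn : thm61_nonsplitMultiplicative) (hJs : thm61_splitMultiplicative)
    (hHn : exists_isMultCanonical) (hHs : exists_isSplitMultCanonical)
    (hD : thm1_padicBSD_rankOne_multiplicative)
    (hGZK : rank_eq_analyticRank_of_analyticRank_le_one) (hpar : nonempty_modularParametrizationData) :
    ∀ (W : WeierstrassCurve ℚ) [W.IsElliptic] [W.IsGloballyMinimal] (p : ℕ) [Fact p.Prime],
      ClassX11b W p → 5 ≤ p → Surj W p → MuAnZeroAt W p →
      (¬ W.HasSplitMultiplicativeReductionAtPrime p →
        ∀ {N : ℕ} [NeZero N] (f : CuspForm (Gamma0 N) 2) (L : PowerSeries ℚ_[p]),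
          IsNewformOf W f → IsMultPAdicLFunctionOf f p (-1) L → PowerSeries.coeff 1 L ≠ 0) →
      (W.HasSplitMultiplicativeReductionAtPrime p →
        ∃ (m : ℕ) (_ : Fact m.Prime), m ≠ p ∧ W.HasMultiplicativeReductionAtPrime m) →
      (W.HasSplitMultiplicativeReductionAtPrime p →
        ∀ {N : ℕ} [NeZero N] (f : CuspForm (Gamma0 N) 2) (L : PowerSeries ℚ_[p]),
          IsNewformOf W f → IsSplitMultPAdicLFunctionOf f p L → PowerSeries.coeff 2 L ≠ 0) →
      BSDp W p :=
  fun W _ _ p _ hX hp hsurj hμ hc1 hm hc2 =>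
    bsdp_of_namedFacts_bdd_of_coeff_ne_zero W p hHida hMTT h311 hT1a hT2 hT1b h61 h326 hKato hJn hJs
      hHn hHs hD hGZK hpar hX hp hsurj hμ hc1 hm hc2

end Summit.BirchSwinnertonDyer.Rank1Residual.X11b.ClassClosure

end
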